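/-
Copyright (c) 2026 the pub-hodgecm-mathlib formalisation cell (harness21).  Prover seat hodgecm-mathlib-F0P3a-p01 (g37), FLOOR 0, SUPPORTS-ONLY on h413; β-BOARD v1
(assembler's gap cell A′ of the `hRest` coverage ledger 15:37:37Z): the glued strata of tower 1 OFF the glue foot and ABOVE `min(n₂, n₃)` are EMPTY.  2026-09-04.
-/
import Summits.HodgeConjecture.HodgeConjecture.Theorems.F0P3cDyRamLabelledOddPureStrataG1   -- ★ p860827 (LH4-p11 (g8)): brings ★ `stratum_G1_eq`, ★ `depths_of_mapGL_latt_hnf_glued_eq`, ★ `v_diag_eq_one`, DEFS `labelledOddCount`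
import HarnessLib

/-!
# Crux `H413`, line LH4 «(D-RAM) FOUR-FRAME» — (β-BAL) Stage B, the `hRest` coverage cell A′: OFF THE GLUE FOOT, a glued stratum `![2ρ, 2ρ+s, 2ρ+s]` of tower 1 with
# `min(n₂, n₃) < 2ρ` has NO `T`-stable member, so its clean-shell labelled-odd table is `0`

Cell `hodgecm-mathlib` (D-0151), FLOOR 0, crux item H413 = `stmt-HodgeConjecture-24833`, route `HCCMUnconditional`; squad F0∕P3c∕LH4.  THEOREMS ONLY (no `def`, no instance, no
notation, no `sorry`, default heartbeats); ★-only imports; lane `--supports stmt-HodgeConjecture-24833 --as helper` (count-neutral); pays NO row, states NO law.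

THE MATHEMATICS (assembler's partition of the rest shapes for the glue socket ★ `…OddLabelledRestReindex.sum_box_restShape_eq_of_rows`; cell (5) of the 15:37:37Z ledger, the one
cell LH7-p05 (g0)'s SIG-R7 A∕B∕C + ★ p860827's cell zero + R6 did not name).  ★ `stratum_G1_eq` presents every member of the stratum `(2ρ, 2ρ+s, 2ρ+s)` (`ρ, s ≥ 1`) as a
`T`-STABLE glued HNF lattice; OFF the glue foot (`n₁ ≠ n₂ + s`) ★ `depths_of_mapGL_latt_hnf_glued_eq` turns stability into `2ρ + s ≤ n₁ ∧ 2ρ ≤ n₂`, and the isosceles bound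
`min(n₁, n₂) ≤ n₃` (ultrametric, from the element datum) adds `2ρ ≤ n₃`.  Hence `min(n₂, n₃) < 2ρ` leaves the stratum EMPTY (§1) and every cut table over it vanishes (§2), in
particular the β-BOARD common shape (§3) — no cell hypothesis, no read hypothesis, no token.
HONEST LABEL.  Count-neutral helper (an EMPTY cell, value `0`); R6∕R7∕R8, `hRest`, (T3), `hbox`, (β-BAL), (β), T₊ remain OPEN; `HC_CM` is proved only modulo the 7 printed
citations (2 remaining named inputs: hLiu418 = `stmt-HodgeConjecture-24832`, h413 = `stmt-HodgeConjecture-24833`) until rung 0 closes.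

## References
* [Kottwitz1986BaseChangeUnits] R. E. Kottwitz, *Base change for unit elements of Hecke algebras*, Compositio Math. 60 (1986), §1 pp. 240–241 (lattice counts by strata; stability).
* [Serre1980Trees] J.-P. Serre, *Trees*, Springer (1980), Ch. II §1.1 (lattices `g·𝒪^N`, Hermite normal forms).
* [Rogawski1990] J. D. Rogawski, *Automorphic Representations of Unitary Groups in Three Variables*, Ann. of Math. Stud. 123 (1990), §4.9 Prop. 4.9.1 (a)(b) p. 55.
-/

set_option autoImplicit false

noncomputable section

namespace Summit.HodgeConjecture.HodgeConjecture.Cruxes.H413.F0P3cDyRamLabelledOddGluedOffFootHigh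

open Literature.NumberTheory.Automorphic Literature.NumberTheory.Automorphic.HermitianLattice
open Literature.NumberTheory.Automorphic.UnitaryLatticeTree Literature.NumberTheory.Automorphic.UnitaryThreeFourFrame
open Literature.NumberTheory.LocalFields Literature.NumberTheory.LocalFields.WildQuadraticDatum
open Summit.HodgeConjecture.HodgeConjecture.Cruxes.H413.F0P3cDyRamFourFramePieces
open Summit.HodgeConjecture.HodgeConjecture.Cruxes.H413.F0P3cDyRamFourFrameCensusDefs
open Summit.HodgeConjecture.HodgeConjecture.Cruxes.H413.F0P3cDyRamDiagonalTorusDefs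
open Summit.HodgeConjecture.HodgeConjecture.Cruxes.H413.F0P3cDyRamDiagonalStrataDefs
open Summit.HodgeConjecture.HodgeConjecture.Cruxes.H413.F0P3cDyRamLabelledOddCountDefs
open Summit.HodgeConjecture.HodgeConjecture.Cruxes.H413.F0P3cDyRamDiagonalGluedStratum (stratum_G1_eq)
open Summit.HodgeConjecture.HodgeConjecture.Cruxes.H413.F0P3cDyRamDiagonalGluedStability (depths_of_mapGL_latt_hnf_glued_eq)
open Summit.HodgeConjecture.HodgeConjecture.Cruxes.H413.F0P3cDyRamStableCountTypeZero (v_diag_eq_one)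
open scoped Valued WithZero Matrix MatrixGroups

variable {K : Type} [Field K] [Valued K ℤᵐ⁰] {σ : K →+* K} {ϖ : K} {d t : ℕ} {α β : K} {N₀ n₁ n₂ n₃ : ℕ}

/-! ## §1  Off the foot and above `min(n₂, n₃)` the glued stratum of tower 1 is empty -/

/-- **OFF THE GLUE FOOT, EVERY MEMBER OF THE STRATUM `(2ρ, 2ρ+s, 2ρ+s)` HAS `2ρ + s ≤ n₁`, `2ρ ≤ n₂` AND `2ρ ≤ n₃`** (`T`-stability read through ★ `depths_of_mapGL_latt_hnf_glued_eq`,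
plus the isosceles bound `min(n₁, n₂) ≤ n₃`).  No cell, read or token hypothesis. [cite: Kottwitz1986BaseChangeUnits, §1 pp. 240–241] [cite: Serre1980Trees, Ch. II §1.1] -/
theorem depths_of_mem_stratum_G1_offFoot (hD : IsRamifiedQuadraticDatum σ ϖ d t) (hE : IsElementDatum σ ϖ N₀ α β n₁ n₂ n₃)
    (T : GL (Fin 3) K) (hT : (T : Matrix (Fin 3) (Fin 3) K) = Matrix.diagonal ![α, β, 1]) {ρ s : ℕ} (hρ : 1 ≤ ρ) (hs : 1 ≤ s) (hfoot : n₁ ≠ n₂ + s)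
    {M : Submodule 𝒪[K] (Fin 3 → K)} (hM : M ∈ stratum σ ϖ T ![2 * ρ, 2 * ρ + s, 2 * ρ + s]) :
    2 * ρ + s ≤ n₁ ∧ 2 * ρ ≤ n₂ ∧ 2 * ρ ≤ n₃ := by
  obtain ⟨-, hvσ, hϖ, hfix, -, -, -⟩ := hD
  have hϖ0 : ϖ ≠ 0 := fun h0 => by rw [h0, map_zero] at hϖ; exact WithZero.coe_ne_zero hϖ.symm
  have hϖlt : Valued.v ϖ < 1 := by rw [hϖ, ← WithZero.exp_zero, WithZero.exp_lt_exp]; norm_num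
  have hα : Valued.v (α - 1) = Valued.v ϖ ^ n₂ := hE.2.2.2.2.2.2.1
  have hβ : Valued.v (β - 1) = Valued.v ϖ ^ n₁ := hE.2.2.2.2.2.1
  have hγ : Valued.v (α - β) = Valued.v ϖ ^ n₃ := hE.2.2.2.2.2.2.2.1
  have hγ' : Valued.v (β - 1 - (α - 1)) = Valued.v ϖ ^ n₃ := by
    rw [show β - 1 - (α - 1) = -(α - β) by ring, Valuation.map_neg, hγ]
  have hpw : ∀ a b : ℕ, Valued.v ϖ ^ a ≤ Valued.v ϖ ^ b ↔ b ≤ a := fun a b => by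
    rw [v_varpi_pow hϖ, v_varpi_pow hϖ, WithZero.exp_le_exp]; omega
  have hn₃min : min n₁ n₂ ≤ n₃ := by
    have h := Valuation.map_sub Valued.v (β - 1) (α - 1)
    rw [hγ', hβ, hα, le_max_iff, hpw, hpw] at h
    omega
  have hsv := v_diag_eq_one hvσ hE
  have hαv : Valued.v α = 1 := by simpa using hsv 0
  have hβv : Valued.v β = 1 := by simpa using hsv 1
  rw [stratum_G1_eq hvσ hfix hϖ T hρ hs] at hM
  obtain ⟨x, ζ, y'', hx, hζ, hy, rfl, hTM, -⟩ := hM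
  have hdet : (!![1, 0, 0; x, ϖ ^ ρ, 0; x * ζ + y'', ϖ ^ ρ * ζ, ϖ ^ (2 * ρ + s)] : Matrix (Fin 3) (Fin 3) K).det ≠ 0 := by
    rw [Matrix.det_fin_three]; simp [hϖ0]
  obtain ⟨h1, h2⟩ := depths_of_mapGL_latt_hnf_glued_eq hϖ0 hϖlt hαv hβv T hT hβ hα ρ s hfoot hx hζ hy
    (Matrix.GeneralLinearGroup.mkOfDetNeZero _ hdet) rfl hTM
  exact ⟨h1, h2, by omega⟩

/-- **A′ · OFF THE GLUE FOOT AND ABOVE `min(n₂, n₃)` THE STRATUM `(2ρ, 2ρ+s, 2ρ+s)` IS EMPTY.** [cite: Kottwitz1986BaseChangeUnits, §1 pp. 240–241] [cite: Serre1980Trees, Ch. II §1.1] -/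
theorem stratum_G1_eq_empty_of_offFoot_of_lt (hD : IsRamifiedQuadraticDatum σ ϖ d t) (hE : IsElementDatum σ ϖ N₀ α β n₁ n₂ n₃)
    (T : GL (Fin 3) K) (hT : (T : Matrix (Fin 3) (Fin 3) K) = Matrix.diagonal ![α, β, 1]) {ρ s : ℕ} (hρ : 1 ≤ ρ) (hs : 1 ≤ s) (hfoot : n₁ ≠ n₂ + s)
    (hlt : min n₂ n₃ < 2 * ρ) : stratum σ ϖ T ![2 * ρ, 2 * ρ + s, 2 * ρ + s] = ∅ := by
  refine Set.eq_empty_iff_forall_notMem.2 fun M hM => ?_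
  obtain ⟨-, h2, h3⟩ := depths_of_mem_stratum_G1_offFoot hD hE T hT hρ hs hfoot hM
  exact absurd (le_min h2 h3) (not_le.2 hlt)

/-! ## §2  Hence every cut table over it vanishes -/

/-- **ANY CUT, ANY WEIGHT: `Σᶠ_{M ∈ stratum (2ρ, 2ρ+s, 2ρ+s), Q M} f M = 0` OFF THE FOOT ABOVE `min(n₂, n₃)`.** [cite: Kottwitz1986BaseChangeUnits, §1 pp. 240–241] -/
theorem finsum_stratum_G1_sep_eq_zero_of_offFoot_of_lt (hD : IsRamifiedQuadraticDatum σ ϖ d t) (hE : IsElementDatum σ ϖ N₀ α β n₁ n₂ n₃)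
    (T : GL (Fin 3) K) (hT : (T : Matrix (Fin 3) (Fin 3) K) = Matrix.diagonal ![α, β, 1]) {ρ s : ℕ} (hρ : 1 ≤ ρ) (hs : 1 ≤ s) (hfoot : n₁ ≠ n₂ + s)
    (hlt : min n₂ n₃ < 2 * ρ) (Q : Submodule 𝒪[K] (Fin 3 → K) → Prop) (f : Submodule 𝒪[K] (Fin 3 → K) → ℚ) :
    ∑ᶠ M ∈ {M : Submodule 𝒪[K] (Fin 3 → K) | M ∈ stratum σ ϖ T ![2 * ρ, 2 * ρ + s, 2 * ρ + s] ∧ Q M}, f M = 0 := by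
  have hempty : {M : Submodule 𝒪[K] (Fin 3 → K) | M ∈ stratum σ ϖ T ![2 * ρ, 2 * ρ + s, 2 * ρ + s] ∧ Q M} = ∅ := by
    refine Set.eq_empty_iff_forall_notMem.2 fun M hM => ?_
    have h := hM.1
    rw [stratum_G1_eq_empty_of_offFoot_of_lt hD hE T hT hρ hs hfoot hlt] at h
    exact h
  rw [hempty, finsum_mem_empty]

/-! ## §3  β-BOARD common shape: cell A′ of the `hRest` partition -/

/-- **A′ · β-BOARD COMMON SHAPE — tower 1, OFF THE FOOT (`n₁ ≠ n₂ + s`), ABOVE `min(n₂, n₃)` (`min n₂ n₃ < 2ρ`): the clean-shell labelled-odd table of the stratum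
`(2ρ, 2ρ+s, 2ρ+s)` is `0`** in every slot, for any label and any square level — the cell (5) of the assembler's `hRest` partition (read TRUE or FALSE alike; covers in particular the
special tower's read line above the glue foot, e.g. `(n₁,n₂,n₃) = (10,6,6)`, `a = (8,10,10)`).  No cell, read or token hypothesis.
[cite: Kottwitz1986BaseChangeUnits, §1 pp. 240–241] [cite: Rogawski1990, §4.9 Prop. 4.9.1 (a)(b) p. 55] [cite: Serre1980Trees, Ch. II §1.1] -/
theorem finsum_stratum_G1_shell_labelledOdd_div_relIndex_eq_zero_of_offFoot_of_lt (hD : IsRamifiedQuadraticDatum σ ϖ d t)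
    (hE : IsElementDatum σ ϖ N₀ α β n₁ n₂ n₃) (T : GL (Fin 3) K) (hT : (T : Matrix (Fin 3) (Fin 3) K) = Matrix.diagonal ![α, β, 1])
    (ρ s : ℕ) (hρ : 1 ≤ ρ) (hs : 1 ≤ s) (hfoot : n₁ ≠ n₂ + s) (hlt : min n₂ n₃ < 2 * ρ) (ℓ₂ : ℕ) (i : Fin 3)
    (Λ : Submodule 𝒪[K] (Fin 3 → K) → (Fin 3 → K) → Prop) :
    ∑ᶠ M ∈ {M : Submodule 𝒪[K] (Fin 3 → K) | M ∈ stratum σ ϖ T ![2 * ρ, 2 * ρ + s, 2 * ρ + s] ∧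
        (LatticeInLevel ϖ (d % 2) (Matrix.diagonal ![α - 1, β - 1, 0]) M ∧ ¬ LatticeInLevel ϖ (d % 2 + 1) (Matrix.diagonal ![α - 1, β - 1, 0]) M ∧
          LatticeInLevel ϖ ℓ₂ (Matrix.diagonal ![(α - 1) * (α - 1), (β - 1) * (β - 1), 0]) M)},
      (labelledOddCount σ ϖ 0 i Λ M : ℚ) / ((((unitStabilizer M).map (unitNormMap σ 3)).relIndex (fixedUnitTorus σ 3) : ℕ) : ℚ) = 0 :=
  finsum_stratum_G1_sep_eq_zero_of_offFoot_of_lt hD hE T hT hρ hs hfoot hlt _ _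

end Summit.HodgeConjecture.HodgeConjecture.Cruxes.H413.F0P3cDyRamLabelledOddGluedOffFootHigh

end
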